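import Summits.CriticalPhenomena.PercolationContinuityZ3.Theorems.PercNearOneGluingNoHeavyLowerTailSahiSlotCell34Cover
import Summits.CriticalPhenomena.PercolationContinuityZ3.Theorems.PercNearOneGluingNoHeavyLowerTailSahiSlotPatternSaturationColouring
import Summits.CriticalPhenomena.PercolationContinuityZ3.Theorems.PercNearOneGluingNoHeavyLowerTailSahiSlotCell34Shard01
import Summits.CriticalPhenomena.PercolationContinuityZ3.Theorems.PercNearOneGluingNoHeavyLowerTailSahiSlotCell34Shard02
import Summits.CriticalPhenomena.PercolationContinuityZ3.Theorems.PercNearOneGluingNoHeavyLowerTailSahiSlotCell34Shard03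
import Summits.CriticalPhenomena.PercolationContinuityZ3.Theorems.PercNearOneGluingNoHeavyLowerTailSahiSlotCell34Shard04
import Summits.CriticalPhenomena.PercolationContinuityZ3.Theorems.PercNearOneGluingNoHeavyLowerTailSahiSlotCell34Shard05
import Summits.CriticalPhenomena.PercolationContinuityZ3.Theorems.PercNearOneGluingNoHeavyLowerTailSahiSlotCell34Shard06
import Summits.CriticalPhenomena.PercolationContinuityZ3.Theorems.PercNearOneGluingNoHeavyLowerTailSahiSlotCell34Shard07
import Summits.CriticalPhenomena.PercolationContinuityZ3.Theorems.PercNearOneGluingNoHeavyLowerTailSahiSlotCell34Shard08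
import Summits.CriticalPhenomena.PercolationContinuityZ3.Theorems.PercNearOneGluingNoHeavyLowerTailSahiSlotCell34Shard09
import Summits.CriticalPhenomena.PercolationContinuityZ3.Theorems.PercNearOneGluingNoHeavyLowerTailSahiSlotCell34Shard10
import Summits.CriticalPhenomena.PercolationContinuityZ3.Theorems.PercNearOneGluingNoHeavyLowerTailSahiSlotCell34Shard11
import Summits.CriticalPhenomena.PercolationContinuityZ3.Theorems.PercNearOneGluingNoHeavyLowerTailSahiSlotCell34Shard12
import Summits.CriticalPhenomena.PercolationContinuityZ3.Theorems.PercNearOneGluingNoHeavyLowerTailSahiSlotCell34Shard13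
import Summits.CriticalPhenomena.PercolationContinuityZ3.Theorems.PercNearOneGluingNoHeavyLowerTailSahiSlotCell34Shard14
import Summits.CriticalPhenomena.PercolationContinuityZ3.Theorems.PercNearOneGluingNoHeavyLowerTailSahiSlotCell34Shard15
import Summits.CriticalPhenomena.PercolationContinuityZ3.Theorems.PercNearOneGluingNoHeavyLowerTailSahiSlotCell34Shard16
import Summits.CriticalPhenomena.PercolationContinuityZ3.Theorems.PercNearOneGluingNoHeavyLowerTailSahiSlotCell34Shard17
import Summits.CriticalPhenomena.PercolationContinuityZ3.Theorems.PercNearOneGluingNoHeavyLowerTailSahiSlotCell34Shard18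
import Summits.CriticalPhenomena.PercolationContinuityZ3.Theorems.PercNearOneGluingNoHeavyLowerTailSahiSlotCell34Shard19
import Summits.CriticalPhenomena.PercolationContinuityZ3.Theorems.PercNearOneGluingNoHeavyLowerTailSahiSlotCell34Shard20

/-!
# THE CELL `(3,4)` IS A THEOREM: `SlotPatternPos 3 4` — Lieb–Sahi's Conjecture 1.1 on `[0,1]^3` at order 4, coefficientwise, in the kernel

Support file of the one-cut programme (crux `NoHeavyLowerTail`, stmt-CriticalPhenomena-4575; cell `prim-masterthm`, seat P3, gen 19;
`run/shared/lean/prim/prim-masterthm/prim-masterthm-p3/HIERARCHY.md` §27; memo `run/shared/lean/prim/prim-masterthm/FROM-prim-masterthm-p3-g19-CELL34-KERNEL.md`).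

THEOREM **`SahiSlot.slotPatternPos_three_four : SlotPatternPos 3 4`** — the order-4 pattern functional `patternForm 3 4` (P3 gen 18) is nonnegative on every
quadruple of up-sets of the slot cube `[4]^3`; equivalently prim-sahi's **`PatternPosN 4 3`** (`patternPosN_four_three`).  Consequences (all by landed
reductions): **`liebSahiContinuum_three_four : LiebSahiContinuum 3 4`** (Lieb–Sahi 2022, Conjecture 1.1, for Lebesgue measure on `[0,1]^3` and four
positive monotone functions — stated open in print beyond `d ≤ 2`), Sahi's `C_4` for every product probability weight on every product of three finite
chains, COEFFICIENTWISE (`sahiPositive_four_gridW_three`), for every FKG weight on every grid `[b+1]^3` (`fkg_grid_three_four`) and on every finite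
distributive lattice of J-width `≤ 3` (`sahiPositive_four_of_latticeEmbedding_three`).

PROOF = prim-sahi-typer gen 27's SATURATION REDUCTION (`SahiSlot.slotPatternPos_three_four_of_colouring`: under P3's sign law it suffices that
`patternForm 3 4 ≥ 0` on the coloured-antichain families `V_i = {q | ∀ p ∈ N, c p = i → ¬ q ≤ p}`, `N` an antichain of `[4]^3`, `c` a 4-colouring)
+ THE KERNEL CERTIFICATE of this lane: the checker `SahiSlot34.checkRange` (`…SahiSlotCell34Check`; Latin-transversal form `Φ = Σ_L Ψ(M_L)` maintained
along the colouring search, 36 table look-ups per removed cell) run by `native_decide` in twenty shards (`…Shard01–20`, ≈ 1.9·10^8 cell updates,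
36 017 202 leaves) over the 40 238 axis-canonical antichains × restricted-growth colourings, its SOUNDNESS (`…Facts`, `…Search`:
`checkMask_sound`), the IDENTIFICATION `Φ = sStarN 4 3 = patternForm 3 4` (`…Ident`, via prim-sahi's `copyKernel_four` and P3's
`sStarN_cast_eq_patternForm`), and the COVERING of all coloured antichains by the canonical restricted-growth ones (`…Colour`: `patternForm_perm_slots`;
`…Cover`: completeness of the antichain enumeration, `patternForm_comp_axisPerm`).
HONEST LABEL: COMPUTATIONAL — the certificate shards and a handful of finite table facts are decided by `native_decide` (axiom `Lean.ofReduceBool` /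
`Lean.trustCompiler` through the `native_decide` auxiliaries); everything else is standard.  Five independent external engines (prim-sahi typer g27 ×3, lit g47,
referee g113) and this lane's C engine agree with the kernel run (0 negatives; `Φ ≥ 576` off the zero locus).  The cells `(3,5)`, `(4,4)`, `(d ≥ 5, 3)` and
Sahi's `C_k` / `(M⁺-k)`, `k ≥ 3`, in general remain OPEN. [this work]
-/

namespace Summit.CriticalPhenomena.PercolationContinuityZ3.Theorems

namespace SahiSlot34

open Finset Equiv
open Literature.Combinatorics.Sahi2008 (setInd)

/-- **The twenty shards cover the canonical list**: every canonical antichain with index `< 40 238` passes the search. [this work] -/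
theorem checkMask_getD (a : ℕ) (ha : a < 40238) : checkMask mkCtx (canonList.toArray.getD a 0) = true := by
  have H : ∀ lo n, checkRange lo n = true → lo ≤ a → a < lo + n → checkMask mkCtx (canonList.toArray.getD a 0) = true := by
    intro lo n h h1 h2
    have h' : ((List.range' lo n).all fun a => checkMask mkCtx (canonList.toArray.getD a 0)) = true := h
    rw [List.all_eq_true] at h'
    exact h' a (List.mem_range'_1.2 ⟨h1, h2⟩)
  by_cases h01 : a < 6023
  · exact H 0 6023 checkRange_shard01 (by omega) (by omega)
  by_cases h02 : a < 8247
  · exact H 6023 2224 checkRange_shard02 (by omega) (by omega)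
  by_cases h03 : a < 9261
  · exact H 8247 1014 checkRange_shard03 (by omega) (by omega)
  by_cases h04 : a < 12474
  · exact H 9261 3213 checkRange_shard04 (by omega) (by omega)
  by_cases h05 : a < 15393
  · exact H 12474 2919 checkRange_shard05 (by omega) (by omega)
  by_cases h06 : a < 19379
  · exact H 15393 3986 checkRange_shard06 (by omega) (by omega)
  by_cases h07 : a < 21595
  · exact H 19379 2216 checkRange_shard07 (by omega) (by omega)
  by_cases h08 : a < 22640
  · exact H 21595 1045 checkRange_shard08 (by omega) (by omega)
  by_cases h09 : a < 22929
  · exact H 22640 289 checkRange_shard09 (by omega) (by omega)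
  by_cases h10 : a < 22951
  · exact H 22929 22 checkRange_shard10 (by omega) (by omega)
  by_cases h11 : a < 23134
  · exact H 22951 183 checkRange_shard11 (by omega) (by omega)
  by_cases h12 : a < 24303
  · exact H 23134 1169 checkRange_shard12 (by omega) (by omega)
  by_cases h13 : a < 25831
  · exact H 24303 1528 checkRange_shard13 (by omega) (by omega)
  by_cases h14 : a < 26988
  · exact H 25831 1157 checkRange_shard14 (by omega) (by omega)
  by_cases h15 : a < 30045
  · exact H 26988 3057 checkRange_shard15 (by omega) (by omega)
  by_cases h16 : a < 33143
  · exact H 30045 3098 checkRange_shard16 (by omega) (by omega)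
  by_cases h17 : a < 35412
  · exact H 33143 2269 checkRange_shard17 (by omega) (by omega)
  by_cases h18 : a < 36609
  · exact H 35412 1197 checkRange_shard18 (by omega) (by omega)
  by_cases h19 : a < 36792
  · exact H 36609 183 checkRange_shard19 (by omega) (by omega)
  exact H 36792 3446 checkRange_shard20 (by omega) (by omega)

/-- Every member of `canonList` passes the search. [this work] -/
theorem checkMask_of_mem_canonList {m : ℕ} (hm : m ∈ canonList) : checkMask mkCtx m = true := by
  obtain ⟨a, ha, rfl⟩ := List.getElem_of_mem hm
  have ha' : a < 40238 := by rw [canonList_length] at ha; exact ha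
  have h := checkMask_getD a ha'
  rwa [Array.getD_eq_getD_getElem?, List.getElem?_toArray, List.getElem?_eq_getElem ha, Option.getD_some] at h

/-- **(★) — the finite normal form of the cell `(3,4)`**: the order-4 pattern functional is nonnegative on the coloured-antichain family of EVERY
antichain `N ⊆ [4]^3` and EVERY 4-colouring `c`. [this work] -/
theorem patternForm_colourFamily_nonneg (N : Finset (SahiSlot.Q 3 4)) (c : SahiSlot.Q 3 4 → Fin 4)
    (hN : IsAntichain (· ≤ ·) (N : Set (SahiSlot.Q 3 4))) :
    0 ≤ SahiSlot.patternForm 3 4 (fun i => setInd (colourFamily N c i)) := by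
  obtain ⟨ρ, hρ⟩ := exists_canonical hN
  rw [← patternForm_colourFamily_axImage ρ N c]
  exact patternForm_colourFamily_nonneg_of_checkMask (checkMask_of_mem_canonList hρ) _

end SahiSlot34

namespace SahiSlot

open Finset
open Literature.Combinatorics.Sahi2008
open scoped Classical

/-- **THE CELL `(3,4)`: `SlotPatternPos 3 4`** — for every quadruple of up-sets `U_0, …, U_3` of the slot cube `[4]^3`,
`patternForm 3 4 (1_{U_0}, …, 1_{U_3}) ≥ 0`; i.e. Sahi's `E_4` is COEFFICIENTWISE nonnegative in the point masses for every product weight on every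
product of three finite chains.  (Saturation reduction of prim-sahi-typer gen 27 + this lane's kernel certificate; computational.) [this work] -/
theorem slotPatternPos_three_four : SlotPatternPos 3 4 :=
  slotPatternPos_three_four_of_colouring fun N c hN => SahiSlot34.patternForm_colourFamily_nonneg N c hN

/-- **prim-sahi's `PatternPosN 4 3`** (the same cell in the copy-kernel normal form, through `patternPosN_iff_slotPatternPos`). [this work] -/
theorem patternPosN_four_three : SahiGridPatternN.PatternPosN 4 3 :=
  patternPosN_iff_slotPatternPos.2 slotPatternPos_three_four

/-- **LIEB–SAHI'S CONJECTURE 1.1 ON `[0,1]^3` AT ORDER 4**: for Lebesgue measure on the unit cube of dimension three and any four nonnegative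
monotone functions, `E_4(f_0, f_1, f_2, f_3) ≥ 0`. [this work] -/
theorem liebSahiContinuum_three_four : LiebSahiContinuum 3 4 :=
  liebSahiContinuum_of_slotPatternPos slotPatternPos_three_four

/-- **Sahi's `C_4` for every product probability weight on every product of three finite chains** (`Y` any finite linear order, `g_a` the
axis weights). [this work] -/
theorem sahiPositive_four_gridW_three {Y : Type*} [LinearOrder Y] [Fintype Y] (g : Fin 3 → Y → ℝ) (hg0 : ∀ a y, 0 ≤ g a y)
    (hg1 : ∀ a, ∑ y, g a y = 1) : SahiPositive (gridW g) 4 :=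
  sahiPositive_gridW_of_slotPatternPos slotPatternPos_three_four g hg0 hg1

/-- **Sahi's `C_4` for every FKG weight on every three-dimensional grid `[b+1]^3`.** [this work] -/
theorem fkg_grid_three_four (b : ℕ) (μ : (Fin 3 → Fin (b + 1)) → ℝ) (hμ : IsFKGMeasure μ) : SahiPositive μ 4 :=
  (SahiGridPatternN.cell_three_four_of_patternPosN patternPosN_four_three).2 b μ hμ

/-- **Sahi's `C_4` for every FKG weight on every finite distributive lattice of J-width `≤ 3`** (a lattice embedding into a three-dimensional grid).
[this work] -/
theorem sahiPositive_four_of_latticeEmbedding_three {L : Type*} [DistribLattice L] [Fintype L] [DecidableEq L] {b : ℕ}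
    (e : L → (Fin 3 → Fin (b + 1))) (he : Function.Injective e) (hinf : ∀ x y, e (x ⊓ y) = e x ⊓ e y)
    (hsup : ∀ x y, e (x ⊔ y) = e x ⊔ e y) {μ : L → ℝ} (hμ : IsFKGMeasure μ) : SahiPositive μ 4 :=
  sahiPositive_of_slotPatternPos_of_latticeEmbedding slotPatternPos_three_four e he hinf hsup hμ

end SahiSlot

end Summit.CriticalPhenomena.PercolationContinuityZ3.Theorems
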